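import Summits.BirchSwinnertonDyer.BirchSwinnertonDyer.Theses.SmallImageMuTransfer
import Literature.NumberTheory.EllipticCurves.CMTorsionIrreducibleOrdinaryProofs
import Literature.NumberTheory.EllipticCurves.ComplexMultiplicationHasCMIffProofs
import HarnessLib

/-!
# `MuZeroCMCurves` (stmt-BirchSwinnertonDyer-19234): the irreducibility binder is redundant

Cell `bsd-smallim`, lane `bsd-smallim-kolyx` (KOLYX-MEMO §3(a)). The crux quantifies over CM curves
`A/ℚ` with `A.j ∈ maximalCMJInvariants`, a prime `p ≥ 5` of good reduction with `p ∤ a_p(A)`, AND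
`A.HasIrreducibleModPGaloisRep p`. The last binder follows from the others by two tree theorems:
`hasCM_of_j_mem_maximalCMJInvariants_holds` (`A.j ∈ maximalCMJInvariants → A.HasCM`) and
`WeierstrassCurve.hasIrreducibleModPGaloisRep_of_hasCM_of_five_le` (Serre 1972 §4.5 read at a good
ORDINARY prime `p ≥ 5`: `E[p]` is irreducible for a CM curve — `p` splits in the CM field, the image of
`Γ_K` is the split Cartan subgroup with two distinct characters, and complex conjugation swaps the two
eigenlines). Hence `MuZeroCMCurves` is EQUIVALENT to the same statement without that binder
(`muZeroCMCurves_iff_of_binderFree`, binder-free form spelled out inline), and a closer / consumer may use either form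
(`muZeroCMCurves_apply_of_cm_ordinary`: the crux applied without an irreducibility witness).
Nothing here proves or refutes the crux. [cite: Serre1972, §4.5 and §1.11]
-/

-- D-0017: single-problem summit, so `Summit.BirchSwinnertonDyer.BirchSwinnertonDyer.…` repeats a
-- namespace BY DESIGN.
set_option linter.dupNamespace false
set_option autoImplicit false

noncomputable section

open scoped Classical
open WeierstrassCurve
open Literature.NumberTheory.EllipticCurves
open Literature.NumberTheory.EllipticCurves.ModularForms

namespace Summit.BirchSwinnertonDyer.BirchSwinnertonDyer.Theorems.MuZeroCMBinders

open Summit.BirchSwinnertonDyer.BirchSwinnertonDyer.Theses.SmallImageMuTransfer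

/-- **At a good ordinary `p ≥ 5`, a curve with `j ∈ maximalCMJInvariants` has irreducible `E[p]`**
(tree: `hasCM_of_j_mem_maximalCMJInvariants_holds` + Serre §4.5 at an ordinary prime,
`hasIrreducibleModPGaloisRep_of_hasCM_of_five_le`). [cite: Serre1972, §4.5 and §1.11] -/
theorem hasIrreducibleModPGaloisRep_of_j_mem_maximalCMJInvariants (A : WeierstrassCurve ℚ)
    [A.IsElliptic] [A.IsGloballyMinimal] (p : ℕ) [Fact p.Prime] (hp : 5 ≤ p)
    (hj : A.j ∈ Literature.NumberTheory.EllipticCurves.maximalCMJInvariants)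
    (hgood : A.HasGoodReductionAtPrime p) (hord : ¬ (p : ℤ) ∣ A.frobeniusTrace p) :
    A.HasIrreducibleModPGaloisRep p :=
  A.hasIrreducibleModPGaloisRep_of_hasCM_of_five_le (hasCM_of_j_mem_maximalCMJInvariants_holds A hj)
    p hp hgood hord

/-- **The irreducibility binder of `MuZeroCMCurves` is redundant**: the crux is equivalent to its own
text with the hypothesis `A.HasIrreducibleModPGaloisRep p →` deleted (spelled out on the right; no new
notion is introduced). [cite: Serre1972, §4.5 and §1.11] -/
theorem muZeroCMCurves_iff_of_binderFree : MuZeroCMCurves ↔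
    (∀ (A : WeierstrassCurve ℚ) [A.IsElliptic] [A.IsGloballyMinimal] (p : ℕ) [Fact p.Prime], 5 ≤ p →
      A.j ∈ Literature.NumberTheory.EllipticCurves.maximalCMJInvariants → A.HasGoodReductionAtPrime p →
      ¬ (p : ℤ) ∣ A.frobeniusTrace p →
      ∀ [NeZero (A.conductorNorm ℤ)] (fA : CuspForm (CongruenceSubgroup.Gamma0 (A.conductorNorm ℤ)) 2),
      Literature.NumberTheory.EllipticCurves.ModularForms.IsNewformOf A fA → ∀ (ϖ : ℚ),
      (ϖ : ℝ) * A.realPeriodRat = Literature.NumberTheory.EllipticCurves.ModularForms.plusPeriod fA →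
      ∃ n : ℕ, ‖PowerSeries.coeff n (PowerSeries.C (ϖ : ℚ_[p]) *
        Literature.NumberTheory.EllipticCurves.padicLFunction fA
          (Literature.NumberTheory.EllipticCurves.unitRoot A p : ℚ_[p]))‖ = 1) := by
  constructor
  · intro h A _ _ p _ hp hj hgood hord _ fA hfA ϖ hϖ
    exact h A p hp hj hgood hord
      (hasIrreducibleModPGaloisRep_of_j_mem_maximalCMJInvariants A p hp hj hgood hord) fA hfA ϖ hϖ
  · intro h A _ _ p _ hp hj hgood hord _ _ fA hfA ϖ hϖ
    exact h A p hp hj hgood hord fA hfA ϖ hϖ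

/-- **Consumer form**: `MuZeroCMCurves` applied at a CM pair `(A, p)` WITHOUT an irreducibility
witness. [cite: Serre1972, §4.5 and §1.11] -/
theorem muZeroCMCurves_apply_of_cm_ordinary (h : MuZeroCMCurves) (A : WeierstrassCurve ℚ)
    [A.IsElliptic] [A.IsGloballyMinimal] (p : ℕ) [Fact p.Prime] (hp : 5 ≤ p)
    (hj : A.j ∈ Literature.NumberTheory.EllipticCurves.maximalCMJInvariants)
    (hgood : A.HasGoodReductionAtPrime p) (hord : ¬ (p : ℤ) ∣ A.frobeniusTrace p)
    [NeZero (A.conductorNorm ℤ)] (fA : CuspForm (CongruenceSubgroup.Gamma0 (A.conductorNorm ℤ)) 2)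
    (hfA : Literature.NumberTheory.EllipticCurves.ModularForms.IsNewformOf A fA) (ϖ : ℚ)
    (hϖ : (ϖ : ℝ) * A.realPeriodRat =
      Literature.NumberTheory.EllipticCurves.ModularForms.plusPeriod fA) :
    ∃ n : ℕ, ‖PowerSeries.coeff n (PowerSeries.C (ϖ : ℚ_[p]) *
      Literature.NumberTheory.EllipticCurves.padicLFunction fA
        (Literature.NumberTheory.EllipticCurves.unitRoot A p : ℚ_[p]))‖ = 1 :=
  muZeroCMCurves_iff_of_binderFree.mp h A p hp hj hgood hord fA hfA ϖ hϖ

end Summit.BirchSwinnertonDyer.BirchSwinnertonDyer.Theorems.MuZeroCMBinders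

end
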